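import Summits.Parity.GeneralizedHardyLittlewood.Theses.LeeYangFibres
import Summits.Parity.GeneralizedHardyLittlewood.Theorems.LeeYangFibresPrimeCellsRelativeLocator
import Summits.Parity.GeneralizedHardyLittlewood.Theorems.LeeYangFibresHyperbolicityClipsParityPrep
import Summits.Parity.GeneralizedHardyLittlewood.Theorems.LeeYangFibresFibreHyperbolicityGhostFree
import HarnessLib

/-!
# Crux `PrimeCellsRelative` (stmt-Parity-14112), line `Sketch`: the ghost-free cell law implies the crux

Companion to `Theorems/LeeYangFibresPrimeCellsRelativeLocator` (the crux between `DimOne`, its twin node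
`RelativeDimOne` and the twin prime conjecture) and `Theorems/LeeYangFibresPrimeCellsRelativeHardness` (the
in-route closure path `CellParityLaw → FibreHyperbolicity → PrimeCellsRelative` and `L`-function hardness).
This file records one more edge of the route's dependency web, kernel-checked:

* `primeCellsRelative_of_ghostFreeCellLaw` — the residual registered stub of crux `FibreHyperbolicity`'s line
  `model-transfer` (`stub_ghostFree : ∀ t ≥ 2, GhostFreeCellLaw t`: joint rough Ω-cells of a non-degenerate `d = 1`
  system follow the independent-anatomy × singular-series model with NO parity ghosts, error `ε N / log^t N`)
  implies the crux BY ITSELF — for `t ≥ 2` specialise to `u = 2` and the prime cell `j = (1,…,1)`, where the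
  model is `β_∞ 𝔖 (A₁(N)/N)^t ≥ 0` (the `t = 1` slice is the theorem `primeCellsRelative_at_one`); no
  hyperbolicity and no clipping are needed on this path;
* hence `relativeDimOne_of_ghostFreeCellLaw` (the hypothesis of the route's `closes`) and
  `ghostFreeCellLaw_implies_twinPrimeConjecture`: that stub is at least as hard as this crux (twin-prime-hard,
  and `UniformCharPNT`-hard through `primeCellsRelative_implies_uniformCharPNT` of the Hardness file).

References: B. Green, T. Tao, *Linear equations in primes*, Ann. of Math. 171 (2010), Conj. 1.4 [GreenTao2010];
G. H. Hardy, J. E. Littlewood, *Partitio Numerorum III*, Acta Math. 44 (1923) [HardyLittlewood1923].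
-/
noncomputable section

namespace Summit.Parity.GeneralizedHardyLittlewood.Cruxes.PrimeCellsRelative.Sketch

open scoped BigOperators Classical
open Finset Literature.NumberTheory.Sieve
open Summit.Parity.GeneralizedHardyLittlewood.Theses.LeeYangFibres
open Summit.Parity.GeneralizedHardyLittlewood.Cruxes.FibreHyperbolicity.ModelTransfer (GhostFreeCellLaw jointCell)

/-- Elementary: `0 ≤ M`, `0 ≤ ε` and `|S - M| ≤ ε B` give `|S - M| ≤ ε (M + B)`. -/
theorem abs_sub_le_mul_add_of_nonneg {S M B ε : ℝ} (hM : 0 ≤ M) (hε : 0 ≤ ε) (h : |S - M| ≤ ε * B) :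
    |S - M| ≤ ε * (M + B) := by
  have := mul_nonneg hε hM
  nlinarith

/-- **The ghost-free cell law implies the crux, by itself.** If for every `t ≥ 2` the joint rough Ω-cells
of non-degenerate `d = 1` systems follow the independent-anatomy × singular-series model with error
`ε N / log^t N` — `∀ t ≥ 2, GhostFreeCellLaw t`, verbatim the residual registered stub `stub_ghostFree` of crux
`FibreHyperbolicity`'s line `model-transfer` — then `PrimeCellsRelative` holds: for `t ≥ 2` take `u = 2` and the
prime cell `j = (1,…,1)`, where the model is `β_∞ 𝔖 (A₁(N)/N)^t ≥ 0`, so the absolute error `ε N / log^t N` is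
within the crux's `ε (M₁ + N / log^t N)`; the slice `t = 1` is the THEOREM `primeCellsRelative_at_one`. No
hyperbolicity and no clipping enter on this path. [cite: GreenTao2010, Conj. 1.4] -/
theorem primeCellsRelative_of_ghostFreeCellLaw (hG : ∀ t : ℕ, 2 ≤ t → GhostFreeCellLaw t) :
    PrimeCellsRelative := by
  intro t L ht ε hε
  rcases Nat.lt_or_ge t 2 with ht2 | ht2
  · obtain rfl : t = 1 := by omega
    exact primeCellsRelative_at_one L ε hε
  obtain ⟨N₀, hN₀⟩ := hG t ht2 L 2 le_rfl ε hε
  refine ⟨2, le_rfl, N₀, fun N hN Ψ hΨ hL K hK hKN => ?_⟩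
  have h := hN₀ N hN Ψ hΨ hL K hK hKN (fun _ => 1) fun _ => ⟨le_rfl, by norm_num⟩
  rw [Finset.prod_const, Finset.card_univ, Fintype.card_fin, mul_div_assoc] at h
  refine abs_sub_le_mul_add_of_nonneg ?_ hε.le h
  exact mul_nonneg (Theorems.HyperbolicityClipsParity.archFactor_mul_singularProduct_nonneg Ψ hΨ K)
    (pow_nonneg (div_nonneg (Nat.cast_nonneg _) (Nat.cast_nonneg _)) t)

/-- **Hence the ghost-free cell law implies `RelativeDimOne`** (item stmt-Parity-14113), through the crux and the
PROVED `cellsToRelativeDimOne_proof` (stmt-Parity-14115). [cite: GreenTao2010, Conj. 1.4] -/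
theorem relativeDimOne_of_ghostFreeCellLaw (hG : ∀ t : ℕ, 2 ≤ t → GhostFreeCellLaw t) : RelativeDimOne :=
  Theorems.LeeYangFibresCells.cellsToRelativeDimOne_proof (primeCellsRelative_of_ghostFreeCellLaw hG)

/-- **And the twin prime conjecture**: the residual stub of crux `FibreHyperbolicity`'s line is twin-prime-hard.
[cite: HardyLittlewood1923, Conjecture B] -/
theorem ghostFreeCellLaw_implies_twinPrimeConjecture (hG : ∀ t : ℕ, 2 ≤ t → GhostFreeCellLaw t) :
    Literature.NumberTheory.Sieve.TwinPrimeConjecture :=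
  primeCellsRelative_implies_twinPrimeConjecture (primeCellsRelative_of_ghostFreeCellLaw hG)

end Summit.Parity.GeneralizedHardyLittlewood.Cruxes.PrimeCellsRelative.Sketch

end
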